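import Literature.AlgebraicGeometry.Resolution.AlterationsNormalFormBlowup
import Literature.AlgebraicGeometry.Resolution.BlowupRegularPoints
import HarnessLib

/-!
# De Jong's alteration theorem: 3.5 ("the situation is further explained in 3.5") in four parts

Topic: `Literature/AlgebraicGeometry/Resolution`. Companion to `AlterationsNormalFormBlowup.lean`,
which vendors the second sentence of de Jong 1996, 4.24 — a pair `(X, Z)` in Situation 4.23
(`DeJong1996.SemiStablePair f g D τ`, `Z = ⋃ᵢ τᵢ(Y) ∪ f⁻¹(D)`) with `codim(Sing(X), X) ≥ 3` IS
in Situation 4.25 (`DeJong1996.NormalFormPair (f ≫ g) Z d`, `AlterationsNormalForm.lean`) — as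
ONE named fact `DeJong1996SemiStablePairIsNormalForm`. The printed text makes four separate
claims, with four separate arguments, and this file vendors them separately and PROVES the
fifth ingredient and the assembly:

> "(Of course the sections `τᵢ` still map into the smooth locus of `f`; in fact, [B2] `Z` is
> already everywhere a divisor with normal crossings, except in the singular points of `X`.
> Furthermore, [B1] it is a divisor, as `D` is a divisor and `τᵢ(Y)` is a divisor.) The
> situation is further explained in 3.5." (4.24, p. 75) — "3.5. (Local description of the case
> `codim(Sing(X), X) ≥ 3`.) [B3] Looking at the equations `Q - t₁^{n₁} ⋯ t_r^{n_r}` for a point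
> `x ∈ Sing(X)` as in 3.3, we see that we must have `nᵢ ∈ {0, 1}`. Thus `B` looks like
> `A'⟦u, v⟧/(Q - t₁ ⋯ t_s)` for some `2 ≤ s ≤ r` and `D` at `s` is defined by `t₁ ⋯ t_r = 0`. We
> remark that this implies that `Sing(X)` has pure codimension three in `X`. … [B5] Let
> `Sing(X) = ⋃ Eᵢ` be the decomposition into irreducible components of `Sing(X)`. Each `Eᵢ`
> maps in a finite étale manner to an irreducible component of some `Dᵢ ∩ Dⱼ`, `i ≠ j`, hence
> `Eᵢ` is a regular scheme." (3.5, p. 64)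

* `DeJong1996SemiStableBoundaryIsDivisor` — NAMED FACT [B1]: `Z` is the support of an
  effective Cartier divisor (2.3).
* `DeJong1996SemiStableBoundaryNormalCrossings` — NAMED FACT [B2] (with 3.3 for the regular
  points of `Sing(f)`: "if `Σ nᵢ = 1`, then the point `x` is regular on `X`", where
  `B ≅ A⟦u, v⟧/(uv - t₁)` and `Z = f⁻¹(D)` is `uv · t₂ ⋯ t_r = 0`): at every nonsingular closed
  point of `Z`, formally `(𝒪̂_{X,x}, Î_Z) ≅ (k⟦x₁, …, x_d⟧, (x₁ ⋯ x_r))`, `1 ≤ r ≤ d`.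
* `DeJong1996CodimThreeNodalForm` — NAMED FACT [B3]: at every singular closed point,
  `(𝒪̂_{X,x}, Î_Z) ≅ (k⟦u, v, t₁, …, t_{d-1}⟧/(uv - t₁ ⋯ t_s), (t₁ ⋯ t_r))`, `2 ≤ s ≤ r ≤ d - 1`.
* `DeJong1996CodimThreeSingularComponentsRegular` — NAMED FACT [B5]: the irreducible
  components of `Sing(X)`, with their reduced structure, are regular schemes.
* PROVED [B4]: the singular locus of `X` is closed (`X` is of finite type over the perfect
  field `k`; `isOpen_regularLocus_of_locallyOfFiniteType_perfectField`), and the assembly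
  `DeJong1996SemiStablePairIsNormalForm.of_parts` of the target fact from B1, B2, B3, B5.

B2 and B3 are the nodes carrying the local structure of semi-stable curves (2.23:
`B ≅ A'⟦u, v⟧/(Q - h)`; 3.3) and Cohen's structure theorem for `𝒪̂_{Y,y} ≅ k⟦t₁, …, t_{d-1}⟧`;
B1 carries "a section of a smooth curve is an effective Cartier divisor" and the flat pull-back
of the divisor `D`; B5 the finite étale structure of `Sing(X) → D`.

## Sources

* A. J. de Jong, *Smoothness, semi-stability and alterations*, Publ. Math. IHÉS 83 (1996) 51–93:
  2.3, 2.4 (p. 55), 2.23 (pp. 61–62), 3.3, 3.5 (pp. 63–64), 4.23–4.25 (p. 75).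
* H. Matsumura, *Commutative Ring Theory* (1986), §30, Cor. to Thm. 30.5 (the regular locus of
  a finitely generated algebra over a perfect field is open), via `BlowupRegularPoints.lean`.
-/

noncomputable section

open CategoryTheory CategoryTheory.Limits AlgebraicGeometry TopologicalSpace Topology

namespace Literature.AlgebraicGeometry.Resolution

universe u

open IsLocalRing Scheme.IdealSheafData

/-! ## The four printed claims as named facts -/

/-- NAMED FACT — **de Jong 1996, 4.24 [B1]: the boundary of Situation 4.23 is a divisor.**
"Furthermore, it [`Z = τ₁(Y) ∪ … ∪ τₙ(Y) ∪ f⁻¹(D)`] is a divisor, as `D` is a divisor and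
`τᵢ(Y)` is a divisor." (2.3: "a divisor `D` of a scheme `X` will be a closed subscheme `D ⊂ X`
regularly embedded of codimension 1, i.e. a positive divisor on `X`".) Rendered for a pair in
Situation 4.23 over an algebraically closed field (`DeJong1996.SemiStablePair f g D τ`): the
boundary `DeJong1996.semiStableBoundary f D τ` is the support of an effective Cartier divisor,
i.e. of an ideal sheaf which is locally generated by a non-zero-divisor (`IsEffectiveCartier`),
as required by Situation 4.25 (`DeJong1996.NormalFormPair.exists_isEffectiveCartier`). (The
strict normal crossings divisor `D` is an effective Cartier divisor on the regular `Y`, its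
pull-back along the flat `f` is one on `X`, each `τᵢ(Y)` — a section of `f` inside its smooth
locus, where `f` is smooth of relative dimension one — is one, and so is their sum.) Users take
`(h : DeJong1996SemiStableBoundaryIsDivisor)`. [cite: DeJong1996, 4.24, p. 75] -/
def DeJong1996SemiStableBoundaryIsDivisor : Prop :=
  ∀ (k : Type u) [Field k] [IsAlgClosed k] (X Y : Scheme.{u}) (f : X ⟶ Y)
    (g : Y ⟶ Spec (.of k)) (D : Set Y) (n : ℕ) (τ : Fin n → (Y ⟶ X)),
    DeJong1996.SemiStablePair f g D τ →
      ∃ I : X.IdealSheafData, IsEffectiveCartier I ∧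
        (I.support : Set X) = DeJong1996.semiStableBoundary f D τ

/-- NAMED FACT — **de Jong 1996, 4.24 [B2] with 3.3: the boundary of Situation 4.23 has normal
crossings at the nonsingular points of `X`.** "(Of course the sections `τᵢ` still map into the
smooth locus of `f`; in fact, `Z` is already everywhere a divisor with normal crossings, except
in the singular points of `X`. …)" — at a point where `f` is smooth, `f⁻¹(D)` is the pull-back of
the strict normal crossings divisor `D` and at most one section `τᵢ(Y)`, transversal to the
fibre, passes; at a regular point `x ∈ Sing(f)` (3.3 with `Σ nᵢ = 1`: "if `Σ nᵢ = 1`, then the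
point `x` is regular on `X`") `𝒪̂_{X,x} ≅ A⟦u, v⟧/(uv - t₁) ≅ k⟦u, v, t₂, …, t_{d-1}⟧` with
`Z = f⁻¹(D) = {uv · t₂ ⋯ t_r = 0}`. Rendered in the formal form of Situation 4.25 (i)
(`DeJong1996.NormalFormPair.exists_ringEquiv_of_isRegularLocalRing`), over an algebraically
closed field `k` and with `dim X = d`: for every closed point `x ∈ Z` with `𝒪_{X,x}` regular
there are `1 ≤ r ≤ d` and an isomorphism of the `𝔪ₓ`-adic completion `𝒪̂_{X,x}` with
`k⟦x₁, …, x_d⟧` carrying the completed ideal of (the reduced structure on) `Z` to `(x₁ ⋯ x_r)`.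
Users take `(h : DeJong1996SemiStableBoundaryNormalCrossings)`; it is a node carrying 2.23/3.3
and Cohen's structure theorem. [cite: DeJong1996, 4.24 and 3.3, pp. 63, 75] -/
def DeJong1996SemiStableBoundaryNormalCrossings : Prop :=
  ∀ (k : Type u) [Field k] [IsAlgClosed k] (X Y : Scheme.{u}) (f : X ⟶ Y)
    (g : Y ⟶ Spec (.of k)) (D : Set Y) (n : ℕ) (τ : Fin n → (Y ⟶ X)) (d : ℕ)
    (hS : DeJong1996.SemiStablePair f g D τ), topologicalKrullDim X = d →
      ∀ x : X, IsClosed ({x} : Set X) → IsRegularLocalRing (X.presheaf.stalk x) →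
        x ∈ DeJong1996.semiStableBoundary f D τ →
          ∃ r : ℕ, 1 ≤ r ∧ r ≤ d ∧
            ∃ e : AdicCompletion (maximalIdeal (X.presheaf.stalk x)) (X.presheaf.stalk x) ≃+*
                MvPowerSeries (Fin d) k,
              ∀ (U : X.affineOpens) (hU : x ∈ (U : X.Opens)),
                (completedStalkIdeal (vanishingIdeal ⟨DeJong1996.semiStableBoundary f D τ,
                    hS.isClosed_semiStableBoundary⟩) x U hU).map e.toRingHom =
                  Ideal.span {DeJong1996.normalCrossingsEquation k d r}

/-- NAMED FACT — **de Jong 1996, 3.5 [B3]: the nodal normal form at the singular points when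
`codim(Sing(X), X) ≥ 3`.** "3.5. (Local description of the case `codim(Sing(X), X) ≥ 3`.)
Looking at the equations `Q - t₁^{n₁} ⋯ t_r^{n_r}` for a point `x ∈ Sing(X)` as in 3.3, we see
that we must have `nᵢ ∈ {0, 1}`. Thus `B` looks like `A'⟦u, v⟧/(Q - t₁ ⋯ t_s)` for some
`2 ≤ s ≤ r` and `D` at `s` is defined by `t₁ ⋯ t_r = 0`." (3.3: `B = 𝒪̂_{X,x}`,
`A = 𝒪̂_{Y,f(x)}` with regular parameters `t₁, …, t_{d-1}`, `t₁, …, t_r` the equations of the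
components of `D` through `f(x)`; split case `A' = A`, `Q = uv`, 2.23 — 4.24: "there we
consider only closed points, so that the situation is automatically split"; 4.25 (ii):
"`2 ≤ s ≤ r ≤ d - 1` … `k⟦u, v, t₁, …, t_{d-1}⟧/(uv - t₁ ⋯ t_s)` and `Z` is defined by
`t₁ ⋯ t_r = 0`", a singular point lying on no section.) Rendered in the form of Situation 4.25
(ii) (`DeJong1996.NormalFormPair.exists_ringEquiv_of_not_isRegularLocalRing`), over an
algebraically closed field, for a pair in Situation 4.23 with `codim(Sing(X), X) ≥ 3` (every
non-regular point has `dim 𝒪_{X,x} ≥ 3`) and `dim X = d`: at every closed point `x` with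
`𝒪_{X,x}` not regular there are `2 ≤ s ≤ r ≤ d - 1` and an isomorphism
`𝒪̂_{X,x} ≅ k⟦u, v, t₁, …, t_{d-1}⟧/(uv - t₁ ⋯ t_s)` (`DeJong1996.NodalFamilyRing k (d - 1) s`)
carrying the completed ideal of `Z` to `(t₁ ⋯ t_r)` (`DeJong1996.nodalFamilyBoundary`). Users
take `(h : DeJong1996CodimThreeNodalForm)`; it is a node carrying 2.23/3.3 and Cohen's structure
theorem. [cite: DeJong1996, 3.5, p. 64] -/
def DeJong1996CodimThreeNodalForm : Prop :=
  ∀ (k : Type u) [Field k] [IsAlgClosed k] (X Y : Scheme.{u}) (f : X ⟶ Y)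
    (g : Y ⟶ Spec (.of k)) (D : Set Y) (n : ℕ) (τ : Fin n → (Y ⟶ X)) (d : ℕ)
    (hS : DeJong1996.SemiStablePair f g D τ),
      (∀ x : X, ¬ IsRegularLocalRing (X.presheaf.stalk x) →
          (3 : WithBot ℕ∞) ≤ ringKrullDim (X.presheaf.stalk x)) →
        topologicalKrullDim X = d →
          ∀ x : X, IsClosed ({x} : Set X) → ¬ IsRegularLocalRing (X.presheaf.stalk x) →
            ∃ s r : ℕ, 2 ≤ s ∧ s ≤ r ∧ r ≤ d - 1 ∧
              ∃ e : AdicCompletion (maximalIdeal (X.presheaf.stalk x)) (X.presheaf.stalk x) ≃+*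
                  DeJong1996.NodalFamilyRing k (d - 1) s,
                ∀ (U : X.affineOpens) (hU : x ∈ (U : X.Opens)),
                  (completedStalkIdeal (vanishingIdeal ⟨DeJong1996.semiStableBoundary f D τ,
                      hS.isClosed_semiStableBoundary⟩) x U hU).map e.toRingHom =
                    Ideal.span {DeJong1996.nodalFamilyBoundary k (d - 1) s r}

/-- NAMED FACT — **de Jong 1996, 3.5 [B5]: the components of the singular locus are regular
when `codim(Sing(X), X) ≥ 3`.** "We remark that this implies that `Sing(X)` has pure
codimension three in `X`. (In the equations above `X` is singular along `u = v = t₁ = t₂ = 0`.)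
Let `Sing(X) = ⋃ Eᵢ` be the decomposition into irreducible components of `Sing(X)`. Each `Eᵢ`
maps in a finite étale manner to an irreducible component of some `Dᵢ ∩ Dⱼ`, `i ≠ j`, hence
`Eᵢ` is a regular scheme." (4.25: "Finally, the components of the singular locus of `X` are
nonsingular.") Rendered as in Situation 4.25 (`DeJong1996.NormalFormPair.isRegular_subscheme`),
over an algebraically closed field, for a pair in Situation 4.23 with `codim(Sing(X), X) ≥ 3`:
every irreducible component `E` of the singular locus `{x | 𝒪_{X,x} not regular}` (a subset of
that subspace), its closure in `X` carrying the reduced closed subscheme structure, is a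
regular scheme. Users take `(h : DeJong1996CodimThreeSingularComponentsRegular)`; it is a node
carrying 3.3/3.5 (the trace `(u, v) ⊂ B` of `Sing(f)`, finite étale over `V(t₁ t₂) ⊂ Spec A`).
[cite: DeJong1996, 3.5, p. 64] -/
def DeJong1996CodimThreeSingularComponentsRegular : Prop :=
  ∀ (k : Type u) [Field k] [IsAlgClosed k] (X Y : Scheme.{u}) (f : X ⟶ Y)
    (g : Y ⟶ Spec (.of k)) (D : Set Y) (n : ℕ) (τ : Fin n → (Y ⟶ X)),
    DeJong1996.SemiStablePair f g D τ →
      (∀ x : X, ¬ IsRegularLocalRing (X.presheaf.stalk x) →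
          (3 : WithBot ℕ∞) ≤ ringKrullDim (X.presheaf.stalk x)) →
        ∀ E ∈ irreducibleComponents
            ↥({x : X | ¬ IsRegularLocalRing (X.presheaf.stalk x)} : Set X),
          Scheme.IsRegular
            (vanishingIdeal ⟨closure (Subtype.val '' E), isClosed_closure⟩).subscheme

/-! ## B4: the singular locus is closed -/

namespace DeJong1996.SemiStablePair

variable {k : Type u} [Field k] {X Y : Scheme.{u}} {f : X ⟶ Y} {g : Y ⟶ Spec (.of k)}
  {D : Set Y} {n : ℕ} {τ : Fin n → (Y ⟶ X)}

/-- **The singular locus of the total space of a pair in Situation 4.23 is closed** ("Let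
`Sing(X) = ⋃ Eᵢ` be the decomposition into irreducible components", 3.5): `X` is of finite type
over the perfect field `k`, so its regular locus is open (Matsumura, Cor. to Thm. 30.5;
`isOpen_regularLocus_of_locallyOfFiniteType_perfectField`). [cite: DeJong1996, 3.5, p. 64] -/
theorem isClosed_setOf_not_isRegularLocalRing [PerfectField k] (hS : SemiStablePair f g D τ) :
    IsClosed ({x : X | ¬ IsRegularLocalRing (X.presheaf.stalk x)} : Set X) := by
  haveI := hS.locallyOfFiniteType
  have h := isOpen_regularLocus_of_locallyOfFiniteType_perfectField (f ≫ g)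
  have e : ({x : X | ¬ IsRegularLocalRing (X.presheaf.stalk x)} : Set X) =
      (Scheme.regularLocus X)ᶜ := rfl
  rw [e]
  exact h.isClosed_compl

end DeJong1996.SemiStablePair

/-! ## The assembly -/

/-- **de Jong 1996, 4.24, second sentence, from its printed parts**: the boundary is a divisor
(B1), with normal crossings at the nonsingular points (B2), the nodal normal form at the
singular points (B3, 3.5), the singular locus is closed (B4, proved) with regular components
(B5, 3.5): a pair in Situation 4.23 with `codim(Sing(X), X) ≥ 3` is in Situation 4.25
(`DeJong1996SemiStablePairIsNormalForm` of `AlterationsNormalFormBlowup.lean`).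
[cite: DeJong1996, 3.5 and 4.24, pp. 64, 75] -/
theorem DeJong1996SemiStablePairIsNormalForm.of_parts (h₁ : DeJong1996SemiStableBoundaryIsDivisor.{u})
    (h₂ : DeJong1996SemiStableBoundaryNormalCrossings.{u}) (h₃ : DeJong1996CodimThreeNodalForm.{u})
    (h₅ : DeJong1996CodimThreeSingularComponentsRegular.{u}) :
    DeJong1996SemiStablePairIsNormalForm.{u} := by
  intro k _ _ X Y f g D n τ d hS hcodim hd
  exact
    { isIntegral := hS.isIntegral
      isProjectiveOver := hS.isProjectiveOver
      topologicalKrullDim_eq := hd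
      isClosed := hS.isClosed_semiStableBoundary
      exists_isEffectiveCartier := h₁ k X Y f g D n τ hS
      exists_ringEquiv_of_isRegularLocalRing := h₂ k X Y f g D n τ d hS hd
      exists_ringEquiv_of_not_isRegularLocalRing := h₃ k X Y f g D n τ d hS hcodim hd
      isClosed_setOf_not_isRegularLocalRing := hS.isClosed_setOf_not_isRegularLocalRing
      isRegular_subscheme := h₅ k X Y f g D n τ hS hcodim }

/-- The target of the owning unit, `DeJong1996SemiStablePairNormalForm` (4.24 in sufficiency
form, `AlterationsNormalForm.lean`), from the printed leaves: Lemma 3.2 with its bookkeeping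
(`DeJong1996SemiStableCodimThree`) and the four parts of 3.5/4.24.
[cite: DeJong1996, 4.24, p. 75] -/
theorem DeJong1996SemiStablePairNormalForm.of_codimThree_of_parts
    (hA : DeJong1996SemiStableCodimThree.{u}) (h₁ : DeJong1996SemiStableBoundaryIsDivisor.{u})
    (h₂ : DeJong1996SemiStableBoundaryNormalCrossings.{u}) (h₃ : DeJong1996CodimThreeNodalForm.{u})
    (h₅ : DeJong1996CodimThreeSingularComponentsRegular.{u}) :
    DeJong1996SemiStablePairNormalForm.{u} :=
  DeJong1996SemiStablePairNormalForm.of_codimThree_of_isNormalForm hA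
    (DeJong1996SemiStablePairIsNormalForm.of_parts h₁ h₂ h₃ h₅)

/-! ## Sanity of the cut -/

/-- Sanity: the four parts are implied back by the bundled fact (they are its fields).
[folklore] -/
theorem DeJong1996SemiStablePairIsNormalForm.parts (h : DeJong1996SemiStablePairIsNormalForm.{u}) :
    DeJong1996CodimThreeNodalForm.{u} ∧ DeJong1996CodimThreeSingularComponentsRegular.{u} := by
  refine ⟨fun k _ _ X Y f g D n τ d hS hcodim hd => ?_, fun k _ _ X Y f g D n τ hS hcodim => ?_⟩
  · exact (h k X Y f g D n τ d hS hcodim hd).exists_ringEquiv_of_not_isRegularLocalRing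
  · haveI := hS.isIntegral
    haveI := hS.locallyOfFiniteType
    haveI : CompactSpace X :=
      (HasAffineProperty.iff_of_isAffine (P := @QuasiCompact)).mp hS.quasiCompact
    obtain ⟨d₀, hd₀⟩ := exists_topologicalKrullDim_le_of_locallyOfFiniteType (f ≫ g)
    obtain ⟨d, hd⟩ := exists_topologicalKrullDim_eq_nat hd₀
    exact (h k X Y f g D n τ d hS hcodim hd).isRegular_subscheme

end Literature.AlgebraicGeometry.Resolution

end
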